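import Summits.HodgeConjecture.HodgeConjecture.Theorems.AnchorTransportVariationalHodgeQuasiProjective
import Summits.HodgeConjecture.HodgeConjecture.Theorems.AnchorTransportVariationalHodgePencilSweep
import Literature.AlgebraicGeometry.HodgeTheory.IsoTransport
import HarnessLib

/-!
# Route AnchorTransport — `VariationalHodge` (stmt-HodgeConjecture-1076), line `polar-patch-broken-cycles`: stub `stub_hDirection` (the `H`-direction of Thomas's descent)

Two theorems for the glue `stub_thomasDescentOfSweep` (crux stmt-HodgeConjecture-1076, line
`polar-patch-broken-cycles`):

* `vhc_of_affine_fixed` — the reduction to AFFINE bases for FIXED relative dimension `n` and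
  codimension `p`, quasi-projective total spaces (the fixed-`(n, p)` copy of
  `Theorems.variationalHodge_step_of_affine` + `Theorems.forall_complexPoints_of_affineOpens`; needed
  because `VHCTwoAffine m` is a fixed-`(m, 2)` statement, which the landed all-`(n, p)` reduction
  `Theorems.variationalHodge_of_affine_of_stable` does not accept).
* `hDirection_of_vhcTwo` — **the `H`-direction**: for a pencil `(ι, a)` of a smooth projective
  `(m+1)`-fold `X` with smooth projective total space, smooth of relative dimension `m` over an open
  `V ⊆ ℙ¹` all of whose members are smooth projective `m`-folds (the output shape of
  `PencilThroughRegularHyperplane`, file `S4cRelativeHyperplaneSections.lean`), a rational `(2,2)`-class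
  `c` on `X` and `V₂(m)` over affine bases: if `ι_t^* σ^* c` is algebraic on ONE member `t₁ ∈ V`, it is
  algebraic on EVERY member over `V` — `V₂(m)` along the smooth family
  `familyPullback.snd (proj ι a) (openSubschemeOverι ℙ¹ V)` (base an irreducible smooth open of `ℙ¹`,
  total space open in the projective `X̃`), through `vhc_of_affine_fixed`.
-/

noncomputable section

-- every declaration of this problem lives in `Summit.HodgeConjecture.HodgeConjecture.…` (summit = sub-problem)
set_option linter.dupNamespace false

open CategoryTheory CategoryTheory.Limits AlgebraicGeometry TopologicalSpace
open Literature.AlgebraicGeometry.Motives Literature.AlgebraicGeometry.HodgeTheory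

namespace Summit.HodgeConjecture.HodgeConjecture.Theorems

/-- **Reduction to affine bases, fixed relative dimension and codimension, quasi-projective total
spaces**: if the variational Hodge statement in relative dimension `n` and codimension `p` holds for
families with quasi-projective total space over smooth irreducible AFFINE bases, it holds for such
families over every smooth irreducible base (chain of affine opens through closed points,
`forall_complexPoints_of_affineOpens`; base change to an affine open, `familyPullback`, moving the
hypotheses, the anchor and the conclusion with `map_fiberι_familyPullback_mem_algebraicClasses_iff`;
quasi-projectivity is stable, `isQuasiProjectiveOver_familyPullback`). [folklore] -/
theorem vhc_of_affine_fixed {n p : ℕ}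
    (h : ∀ ⦃𝒳 S : SchemeOver ℂ⦄ (f : 𝒳 ⟶ S), IsSmoothProjectiveFamily f n → IsQuasiProjectiveOver 𝒳 →
      IrreducibleSpace S.left → IsAffine S.left → AlgebraicGeometry.Smooth S.hom →
      ∀ (A : complexBetti 𝒳 (2 * p)),
      (∀ s : ComplexPoints S, IsRationalClass (complexBetti.map (fiberι f s) (2 * p) A) ∧
        IsOfHodgeType n (fiberOver f s) (2 * p) p p (complexBetti.map (fiberι f s) (2 * p) A)) →
      (∃ s₀ : ComplexPoints S,
        complexBetti.map (fiberι f s₀) (2 * p) A ∈ algebraicClasses (fiberOver f s₀) p) →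
      ∀ s : ComplexPoints S,
        complexBetti.map (fiberι f s) (2 * p) A ∈ algebraicClasses (fiberOver f s) p)
    ⦃𝒳 S : SchemeOver ℂ⦄ (f : 𝒳 ⟶ S) (hf : IsSmoothProjectiveFamily f n) (hq : IsQuasiProjectiveOver 𝒳)
    (hirr : IrreducibleSpace S.left) (hsm : AlgebraicGeometry.Smooth S.hom) (A : complexBetti 𝒳 (2 * p))
    (hA : ∀ s : ComplexPoints S, IsRationalClass (complexBetti.map (fiberι f s) (2 * p) A) ∧
      IsOfHodgeType n (fiberOver f s) (2 * p) p p (complexBetti.map (fiberι f s) (2 * p) A))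
    (hs₀ : ∃ s₀ : ComplexPoints S,
      complexBetti.map (fiberι f s₀) (2 * p) A ∈ algebraicClasses (fiberOver f s₀) p)
    (s : ComplexPoints S) :
    complexBetti.map (fiberι f s) (2 * p) A ∈ algebraicClasses (fiberOver f s) p := by
  obtain ⟨s₀, hs₀⟩ := hs₀
  haveI := hirr
  haveI := hsm
  refine forall_complexPoints_of_affineOpens
    (fun t => complexBetti.map (fiberι f t) (2 * p) A ∈ algebraicClasses (fiberOver f t) p)
    (fun U hU a b haU hbU ha => ?_) hs₀ s
  -- adapted from `Theorems.variationalHodge_step_of_affine` with `Q := IsQuasiProjectiveOver`, `n`, `p` fixed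
  haveI : IsOpenImmersion (openSubschemeOverι S U).left := inferInstanceAs (IsOpenImmersion U.ι)
  have hUaff : IsAffine (openSubschemeOver S U).left := hU
  have hUirr : IrreducibleSpace (openSubschemeOver S U).left := by
    change IrreducibleSpace U
    exact isIrreducible_iff_irreducibleSpace.mp ⟨⟨a.pt, haU⟩,
      (PreirreducibleSpace.isPreirreducible_univ (X := S.left)).open_subset U.isOpen
        (Set.subset_univ _)⟩
  have hUsm : AlgebraicGeometry.Smooth (openSubschemeOver S U).hom := by
    change AlgebraicGeometry.Smooth (U.ι ≫ S.hom)
    infer_instance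
  have hrange : Set.range (AlgPoints.map (L := ℂ) (openSubschemeOverι S U)) = {P | P.pt ∈ U} := by
    rw [AlgPoints.range_map_of_isOpenImmersion_holds]
    ext P
    change P.pt ∈ U.ι.opensRange ↔ P.pt ∈ U
    rw [Scheme.Opens.opensRange_ι]
  obtain ⟨a', rfl⟩ : a ∈ Set.range (AlgPoints.map (L := ℂ) (openSubschemeOverι S U)) := by
    rw [hrange]; exact haU
  obtain ⟨b', rfl⟩ : b ∈ Set.range (AlgPoints.map (L := ℂ) (openSubschemeOverι S U)) := by
    rw [hrange]; exact hbU
  rw [← map_fiberι_familyPullback_mem_algebraicClasses_iff f (openSubschemeOverι S U) hf A b']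
  exact h (familyPullback.snd f (openSubschemeOverι S U)) (hf.familyPullback_snd _)
    (isQuasiProjectiveOver_familyPullback f _ inferInstance hq) hUirr hUaff hUsm
    (complexBetti.map (familyPullback.fst f (openSubschemeOverι S U)) (2 * p) A)
    (familyPullback_fibrewise_rational_hodgeType f (openSubschemeOverι S U) A hA)
    ⟨a', (map_fiberι_familyPullback_mem_algebraicClasses_iff f (openSubschemeOverι S U) hf A a').2 ha⟩
    b'

/-- **The restriction of a pencil over an open of good members is a smooth projective family.** For
a pencil `(ι, a)` with smooth projective total space of dimension `m + 1` and an open `V ⊆ ℙ¹` over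
which `π` is smooth of relative dimension `m` with smooth projective `m`-fold members, the base change
`π⁻¹ V ⟶ V` (as `familyPullback.snd π (openSubschemeOverι ℙ¹ V)`) is a smooth projective family of
relative dimension `m` (`pullback.snd π V.ι ≅ π ∣_ V`; properness of `π`; fibres through
`fiberOverFamilyPullbackIso`). [folklore] -/
theorem isSmoothProjectiveFamily_pencil_restrict {m N : ℕ} {X : SchemeOver ℂ}
    (ι : X ⟶ projectiveSpace N ℂ)
    (a : Fin (1 + 1) → Fin (N + 1) → ℂ) (hXt : IsSmoothProjective (m + 1) (LinearSectionNet.total ι a))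
    (V : (projectiveSpace 1 ℂ).left.Opens)
    (hsm : SmoothOfRelativeDimension m ((LinearSectionNet.proj ι a).left ∣_ V))
    (hfib : ∀ t : ComplexPoints (projectiveSpace 1 ℂ), t.pt ∈ V →
      IsSmoothProjective m (fiberOver (LinearSectionNet.proj ι a) t)) :
    IsSmoothProjectiveFamily
      (familyPullback.snd (LinearSectionNet.proj ι a) (openSubschemeOverι (projectiveSpace 1 ℂ) V)) m := by
  have hP : IsSmoothProjective 1 (projectiveSpace 1 ℂ) := isSmoothProjective_projectiveSpace' 1
  haveI : IsOpenImmersion (openSubschemeOverι (projectiveSpace 1 ℂ) V).left :=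
    inferInstanceAs (IsOpenImmersion V.ι)
  -- `π` is proper
  haveI : IsProper (projectiveSpace 1 ℂ).hom := IsSmoothProjective.isProper_holds hP
  haveI : IsProper (LinearSectionNet.total ι a).hom := IsSmoothProjective.isProper_holds hXt
  haveI hproper : IsProper (LinearSectionNet.proj ι a).left := by
    haveI : IsProper ((LinearSectionNet.proj ι a).left ≫ (projectiveSpace 1 ℂ).hom) := by
      rw [Over.w]; infer_instance
    exact IsProper.of_comp (LinearSectionNet.proj ι a).left (projectiveSpace 1 ℂ).hom
  have hrange : Set.range (AlgPoints.map (L := ℂ) (openSubschemeOverι (projectiveSpace 1 ℂ) V)) =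
      {P | P.pt ∈ V} := by
    rw [AlgPoints.range_map_of_isOpenImmersion_holds]
    ext P
    change P.pt ∈ V.ι.opensRange ↔ P.pt ∈ V
    rw [Scheme.Opens.opensRange_ι]
  refine ⟨?_, ?_, fun s' => ?_⟩
  · change SmoothOfRelativeDimension m (pullback.snd (LinearSectionNet.proj ι a).left V.ι)
    rw [← pullbackRestrictIsoRestrict_hom_morphismRestrict,
      MorphismProperty.cancel_left_of_respectsIso (P := @SmoothOfRelativeDimension m)]
    exact hsm
  · change IsProper (pullback.snd (LinearSectionNet.proj ι a).left V.ι)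
    infer_instance
  · have hmem : (AlgPoints.map (openSubschemeOverι (projectiveSpace 1 ℂ) V) s').pt ∈ V := by
      have h : AlgPoints.map (openSubschemeOverι (projectiveSpace 1 ℂ) V) s' ∈
          Set.range (AlgPoints.map (L := ℂ) (openSubschemeOverι (projectiveSpace 1 ℂ) V)) := ⟨s', rfl⟩
      rw [hrange] at h
      exact h
    exact (hfib _ hmem).of_iso
      (fiberOverFamilyPullbackIso (LinearSectionNet.proj ι a) (openSubschemeOverι _ V) s').symm

/-- **The `H`-direction of Thomas's descent.** Let `X` be a smooth projective `(m+1)`-fold with a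
closed immersion `ι : X ⟶ ℙᴺ`, `(ι, a)` a pencil with smooth projective total space `X̃` of dimension
`m + 1`, `V ⊆ ℙ¹` an open over which `π : X̃ ⟶ ℙ¹` is smooth of relative dimension `m` with smooth
projective `m`-fold members, and `c ∈ H⁴(X(ℂ); ℂ)` a rational `(2,2)`-class. Assume `V₂(m)` over affine
bases for quasi-projective total spaces. If `ι_{t₁}^* σ^* c` is algebraic on ONE member `t₁ ∈ V`, then
`ι_t^* σ^* c` is algebraic on EVERY member `t ∈ V`: apply `V₂(m)` (through `vhc_of_affine_fixed`) to
the smooth projective family `π⁻¹V ⟶ V` (`isSmoothProjectiveFamily_pencil_restrict`; base a non-empty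
open of `ℙ¹`, irreducible and smooth; total space open in the projective `X̃`, quasi-projective) and the
class `pr^* σ^* c`, whose fibre restrictions are the `ι_t^* σ^* c` (`map_fiberι_familyPullback`,
`mem_algebraicClasses_map_iff_of_iso`), rational (`IsRationalClass.map`) and of type `(2,2)`
(`IsOfHodgeType.map_of_isSmoothProjective`). [cite: Thomas2005Nodes, §2 proof of Prop. 2 and §5] -/
theorem hDirection_of_vhcTwo {m N : ℕ} {X : SchemeOver ℂ} (hX : IsSmoothProjective (m + 1) X)
    (hV₂ : ∀ ⦃𝒳 S : SchemeOver ℂ⦄ (f : 𝒳 ⟶ S), IsSmoothProjectiveFamily f m → IsQuasiProjectiveOver 𝒳 →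
      IrreducibleSpace S.left → IsAffine S.left → AlgebraicGeometry.Smooth S.hom →
      ∀ (A : complexBetti 𝒳 (2 * 2)),
      (∀ s : ComplexPoints S, IsRationalClass (complexBetti.map (fiberι f s) (2 * 2) A) ∧
        IsOfHodgeType m (fiberOver f s) (2 * 2) 2 2 (complexBetti.map (fiberι f s) (2 * 2) A)) →
      (∃ s₀ : ComplexPoints S,
        complexBetti.map (fiberι f s₀) (2 * 2) A ∈ algebraicClasses (fiberOver f s₀) 2) →
      ∀ s : ComplexPoints S,
        complexBetti.map (fiberι f s) (2 * 2) A ∈ algebraicClasses (fiberOver f s) 2)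
    (ι : X ⟶ projectiveSpace N ℂ) [IsClosedImmersion ι.left]
    (a : Fin (1 + 1) → Fin (N + 1) → ℂ) (hXt : IsSmoothProjective (m + 1) (LinearSectionNet.total ι a))
    (V : (projectiveSpace 1 ℂ).left.Opens)
    (hsm : SmoothOfRelativeDimension m ((LinearSectionNet.proj ι a).left ∣_ V))
    (hfib : ∀ t : ComplexPoints (projectiveSpace 1 ℂ), t.pt ∈ V →
      IsSmoothProjective m (fiberOver (LinearSectionNet.proj ι a) t))
    (c : complexBetti X (2 * 2)) (hc : IsRationalClass c) (hpp : IsOfHodgeType (m + 1) X (2 * 2) 2 2 c)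
    {t₁ : ComplexPoints (projectiveSpace 1 ℂ)} (ht₁ : t₁.pt ∈ V)
    (halg₁ : complexBetti.map (fiberι (LinearSectionNet.proj ι a) t₁) (2 * 2)
        (complexBetti.map (LinearSectionNet.blowDown ι a) (2 * 2) c) ∈
      algebraicClasses (fiberOver (LinearSectionNet.proj ι a) t₁) 2)
    (t : ComplexPoints (projectiveSpace 1 ℂ)) (ht : t.pt ∈ V) :
    complexBetti.map (fiberι (LinearSectionNet.proj ι a) t) (2 * 2)
        (complexBetti.map (LinearSectionNet.blowDown ι a) (2 * 2) c) ∈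
      algebraicClasses (fiberOver (LinearSectionNet.proj ι a) t) 2 := by
  have hP : IsSmoothProjective 1 (projectiveSpace 1 ℂ) := isSmoothProjective_projectiveSpace' 1
  haveI : IrreducibleSpace (projectiveSpace 1 ℂ).left := hP.irreducibleSpace
  haveI : IsOpenImmersion (openSubschemeOverι (projectiveSpace 1 ℂ) V).left :=
    inferInstanceAs (IsOpenImmersion V.ι)
  -- the smooth family over `V`
  have hF : IsSmoothProjectiveFamily
      (familyPullback.snd (LinearSectionNet.proj ι a) (openSubschemeOverι (projectiveSpace 1 ℂ) V)) m :=
    isSmoothProjectiveFamily_pencil_restrict ι a hXt V hsm hfib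
  -- its base: irreducible (non-empty open of `ℙ¹`) and smooth
  have hBirr : IrreducibleSpace (openSubschemeOver (projectiveSpace 1 ℂ) V).left := by
    change IrreducibleSpace V
    exact isIrreducible_iff_irreducibleSpace.mp ⟨⟨t₁.pt, ht₁⟩,
      (PreirreducibleSpace.isPreirreducible_univ (X := (projectiveSpace 1 ℂ).left)).open_subset V.isOpen
        (Set.subset_univ _)⟩
  have hBsm : AlgebraicGeometry.Smooth (openSubschemeOver (projectiveSpace 1 ℂ) V).hom := by
    haveI := hP.smoothOfRelativeDimension
    haveI : AlgebraicGeometry.Smooth (projectiveSpace 1 ℂ).hom := SmoothOfRelativeDimension.smooth 1 _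
    change AlgebraicGeometry.Smooth (V.ι ≫ (projectiveSpace 1 ℂ).hom)
    infer_instance
  -- its total space: open in the projective `X̃`
  have hq : IsQuasiProjectiveOver
      (familyPullback (LinearSectionNet.proj ι a) (openSubschemeOverι (projectiveSpace 1 ℂ) V)) :=
    isQuasiProjectiveOver_familyPullback (LinearSectionNet.proj ι a) _ inferInstance
      (IsQuasiProjectiveOver.of_isProjectiveOver hXt.isProjectiveOver)
  -- lifting the points of `V`
  have hrange : Set.range (AlgPoints.map (L := ℂ) (openSubschemeOverι (projectiveSpace 1 ℂ) V)) =
      {P | P.pt ∈ V} := by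
    rw [AlgPoints.range_map_of_isOpenImmersion_holds]
    ext P
    change P.pt ∈ V.ι.opensRange ↔ P.pt ∈ V
    rw [Scheme.Opens.opensRange_ι]
  obtain ⟨s₁, rfl⟩ : t₁ ∈ Set.range (AlgPoints.map (L := ℂ) (openSubschemeOverι (projectiveSpace 1 ℂ) V)) := by
    rw [hrange]; exact ht₁
  obtain ⟨s, rfl⟩ : t ∈ Set.range (AlgPoints.map (L := ℂ) (openSubschemeOverι (projectiveSpace 1 ℂ) V)) := by
    rw [hrange]; exact ht
  -- the class `pr^* σ^* c` and its fibre restrictions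
  set ct : complexBetti (LinearSectionNet.total ι a) (2 * 2) :=
    complexBetti.map (LinearSectionNet.blowDown ι a) (2 * 2) c with hctdef
  have key : ∀ u : ComplexPoints (openSubschemeOver (projectiveSpace 1 ℂ) V),
      complexBetti.map (fiberι (familyPullback.snd (LinearSectionNet.proj ι a)
          (openSubschemeOverι (projectiveSpace 1 ℂ) V)) u) (2 * 2)
          (complexBetti.map (familyPullback.fst (LinearSectionNet.proj ι a)
            (openSubschemeOverι (projectiveSpace 1 ℂ) V)) (2 * 2) ct) ∈
          algebraicClasses (fiberOver (familyPullback.snd (LinearSectionNet.proj ι a)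
            (openSubschemeOverι (projectiveSpace 1 ℂ) V)) u) 2 ↔
        complexBetti.map (fiberι (LinearSectionNet.proj ι a)
            (AlgPoints.map (openSubschemeOverι (projectiveSpace 1 ℂ) V) u)) (2 * 2) ct ∈
          algebraicClasses (fiberOver (LinearSectionNet.proj ι a)
            (AlgPoints.map (openSubschemeOverι (projectiveSpace 1 ℂ) V) u)) 2 := by
    intro u
    rw [map_fiberι_familyPullback]
    exact mem_algebraicClasses_map_iff_of_iso (fiberOverFamilyPullbackIso _ _ u)
  have hA : ∀ u : ComplexPoints (openSubschemeOver (projectiveSpace 1 ℂ) V),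
      IsRationalClass (complexBetti.map (fiberι (familyPullback.snd (LinearSectionNet.proj ι a)
          (openSubschemeOverι (projectiveSpace 1 ℂ) V)) u) (2 * 2)
          (complexBetti.map (familyPullback.fst (LinearSectionNet.proj ι a)
            (openSubschemeOverι (projectiveSpace 1 ℂ) V)) (2 * 2) ct)) ∧
        IsOfHodgeType m (fiberOver (familyPullback.snd (LinearSectionNet.proj ι a)
            (openSubschemeOverι (projectiveSpace 1 ℂ) V)) u) (2 * 2) 2 2
          (complexBetti.map (fiberι (familyPullback.snd (LinearSectionNet.proj ι a)
            (openSubschemeOverι (projectiveSpace 1 ℂ) V)) u) (2 * 2)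
            (complexBetti.map (familyPullback.fst (LinearSectionNet.proj ι a)
              (openSubschemeOverι (projectiveSpace 1 ℂ) V)) (2 * 2) ct)) := by
    intro u
    have hYu := hF.isSmoothProjective u
    rw [hctdef, ← CategoryTheory.comp_apply, ← complexBetti.map_comp, ← CategoryTheory.comp_apply,
      ← complexBetti.map_comp]
    exact ⟨hc.map _, hpp.map_of_isSmoothProjective hYu hX _⟩
  -- `V₂(m)` along the family, from the one good member `s₁`
  exact (key s).1 (vhc_of_affine_fixed hV₂ _ hF hq hBirr hBsm _ hA ⟨s₁, (key s₁).2 halg₁⟩ s)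

/-- **Registered stub `stub_hDirection` of the line `polar-patch-broken-cycles`** (skeleton
`Cruxes/VariationalHodge/Lines/polar_patch_broken_cycles.lean`, S4h, lead's cycle 1): the `H`-direction
`hDirection_of_vhcTwo` in the registry's binder shape. [cite: Thomas2005Nodes, §2 proof of Prop. 2 and §5] -/
theorem stub_hDirection :
    ∀ {m N : ℕ} {X : SchemeOver ℂ}, IsSmoothProjective (m + 1) X →
      (∀ ⦃𝒳 S : SchemeOver ℂ⦄ (f : 𝒳 ⟶ S), IsSmoothProjectiveFamily f m → IsQuasiProjectiveOver 𝒳 →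
        IrreducibleSpace S.left → IsAffine S.left → AlgebraicGeometry.Smooth S.hom →
        ∀ (A : complexBetti 𝒳 (2 * 2)),
        (∀ s : ComplexPoints S, IsRationalClass (complexBetti.map (fiberι f s) (2 * 2) A) ∧
          IsOfHodgeType m (fiberOver f s) (2 * 2) 2 2 (complexBetti.map (fiberι f s) (2 * 2) A)) →
        (∃ s₀ : ComplexPoints S,
          complexBetti.map (fiberι f s₀) (2 * 2) A ∈ algebraicClasses (fiberOver f s₀) 2) →
        ∀ s : ComplexPoints S,
          complexBetti.map (fiberι f s) (2 * 2) A ∈ algebraicClasses (fiberOver f s) 2) →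
      ∀ (ι : X ⟶ projectiveSpace N ℂ) [IsClosedImmersion ι.left]
        (a : Fin (1 + 1) → Fin (N + 1) → ℂ), IsSmoothProjective (m + 1) (LinearSectionNet.total ι a) →
      ∀ (V : (projectiveSpace 1 ℂ).left.Opens),
        SmoothOfRelativeDimension m ((LinearSectionNet.proj ι a).left ∣_ V) →
        (∀ t : ComplexPoints (projectiveSpace 1 ℂ), t.pt ∈ V →
          IsSmoothProjective m (fiberOver (LinearSectionNet.proj ι a) t)) →
      ∀ (c : complexBetti X (2 * 2)), IsRationalClass c → IsOfHodgeType (m + 1) X (2 * 2) 2 2 c →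
      ∀ {t₁ : ComplexPoints (projectiveSpace 1 ℂ)}, t₁.pt ∈ V →
        complexBetti.map (fiberι (LinearSectionNet.proj ι a) t₁) (2 * 2)
            (complexBetti.map (LinearSectionNet.blowDown ι a) (2 * 2) c) ∈
          algebraicClasses (fiberOver (LinearSectionNet.proj ι a) t₁) 2 →
      ∀ (t : ComplexPoints (projectiveSpace 1 ℂ)), t.pt ∈ V →
        complexBetti.map (fiberι (LinearSectionNet.proj ι a) t) (2 * 2)
            (complexBetti.map (LinearSectionNet.blowDown ι a) (2 * 2) c) ∈
          algebraicClasses (fiberOver (LinearSectionNet.proj ι a) t) 2 :=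
  fun hX hV₂ ι _ a hXt V hsm hfib c hc hpp _ ht₁ halg₁ t ht =>
    hDirection_of_vhcTwo hX hV₂ ι a hXt V hsm hfib c hc hpp ht₁ halg₁ t ht

end Summit.HodgeConjecture.HodgeConjecture.Theorems

end
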